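import Summits.ResolutionOfSingularities.ResolutionOfSingularities.Theorems.PurelyInseparableDim4SpineDictionary
import Summits.ResolutionOfSingularities.ResolutionOfSingularities.Theorems.PurelyInseparableDim4SpinePositional
import Mathlib.Data.ZMod.Basic
import HarnessLib

/-!
# [OURS · res-dim4-pi PR-9b′] The CONVERSE of the support dictionary: on the spine the
  coordinate-centre frame loses nothing — F4-S `SpineTerminatesSomeRule p q` holds iff the support
  game with deletions is won positionally (`PositionalWin4 q`)

Cell `res-dim4-pi` (D-0157 DOOR 2), brick **PR-9b′** (seat `res-dim4-p-7`, bus 16:4xZ; complements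
res-dim4-p-14's state-level trap form PR-12d).  Typed over the TREE: the census frames
`PIDim4.SpineTerminatesSomeRule / SpineTerminatesUnder / SpineEdge` (`…Scope`), `PIDim4.CentreRule /
IsPermissibleRule` (`…Rules`), TY-9's support game `PIDim4.PositionalWin4 / SpineWon / SpinePermissible
/ spineMove` (`…SpineGame`), the support dictionary `PIDim4.SpineDictionary.*` (PR-9b,
`…SpineDictionary`, p648817) and res-dim4-p-14's positional determinacy of the spine game
(`PIDim4.SpinePositional.not_positionalWin4_iff_exists_spineTrap`, `…positionalWin4_iff_forall_wins`,
`…spinePermissible_univ_of_not_spineWon`; `…SpinePositional`, p648897); nothing is restated.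

## What is proved (every exponent `q`; no cleanliness hypothesis anywhere)

* §1 **SUPPORT TRAPS LIFT.**  A support spine-trap (p-14's kill shape for `PositionalWin4`: a set `T`
  of not-yet-won positions in which every permissible `J` has a chart `j ∈ J` whose spine move stays in
  `T`) defeats EVERY permissible coordinate-centre rule over EVERY field: from any state whose residual
  polynomial has support in `T` the rule admits an infinite spine branch
  (`exists_chain_of_spineTrap`, `not_spineTerminatesUnder_of_spineTrap`) — whatever the rule reads
  (coefficients, multiplicities `r`, components `exc`), the support of the next `F` at the chart origin is
  the spine move of the support (PR-9b's `support_step_origin`), the origin is equimultiple and the new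
  `F` is non-zero because the next position is not won.
* §2 **THE CONVERSE over one field**: `positionalWin4_of_exists_spineTerminating_rule : (∃ R,
  IsPermissibleRule q R ∧ SpineTerminatesUnder q R) → PositionalWin4 q` (by p-14's determinacy: no
  positional win ⇒ a nonempty support trap ⇒ §1), and with PR-9b's construction the EXACT existential
  dictionary `exists_spineTerminating_rule_iff_positionalWin4` over ANY single field `K`.
* §3 **F4-S IS THE SUPPORT GAME**: `positionalWin4_of_spineTerminatesSomeRule` (any field of
  characteristic `p` as witness), `spineTerminatesSomeRule_iff_positionalWin4 [Fact p.Prime]`,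
  `spineTerminatesSomeRule_zero_iff_positionalWin4`, the FIELD-INDEPENDENCE
  `spineTerminatesSomeRule_iff_exists_rule` (F4-S holds iff SOME permissible rule over SOME field of
  characteristic `p` has no infinite spine branch), and `spineTerminatesSomeRule_iff_forall_wins`
  (F4-S ⟺ every position of the support game lies in player A's attractor).

Census reading: F4-S `SpineTerminatesSomeRule p q` is EXACTLY the statement that Hironaka's pure
polyhedra game with cleaning deletions on `Finset (Fin 4 →₀ ℕ)` is won by player A from every position;
by PR-9a (p-10) it follows from Spivakovsky's positional win `PurePositionalWin4 q` (named hypothesis,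
PR-9c in progress).  [OURS · counted 0 · AI work weaker than expert review] NOTHING here proves
resolution of singularities in dimension ≥ 4 / characteristic `p`; this is bookkeeping about OUR
candidate frame read at chart origins.  bears_on: LADDER-RESOLUTION:D157-DOOR2 (res-dim4-pi · PR-9b′).
Supports stmt-ResolutionOfSingularities-16155 (helper).
-/

noncomputable section

set_option linter.dupNamespace false -- mandated namespace of this single-conjunct summit

open MvPolynomial Finset

namespace Summit.ResolutionOfSingularities.ResolutionOfSingularities.Theorems.PIDim4

namespace SpineDictionary

open Literature.AlgebraicGeometry.Resolution
open Literature.AlgebraicGeometry.Resolution.CentreBlowup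

section OneField

variable {K : Type} [Field K] [DecidableEq K]

/-! ## §1 Support traps lift to infinite spine branches under every permissible rule -/

/-- **Support traps lift.** Let `T` be a support spine-trap (every `A ∈ T` is not yet won and every
permissible `J` at `A` has a chart `j ∈ J` with `spineMove q J j A ∈ T`) and `R` ANY permissible
coordinate-centre rule.  From every state `s₀` with `supp s₀.F ∈ T` there is an infinite spine branch
under `R` all of whose supports stay in `T`. [folklore] -/
theorem exists_chain_of_spineTrap {q : ℕ} {T : Set SpinePos}
    (hT : ∀ A ∈ T, ¬ SpineWon q A ∧ ∀ J, SpinePermissible q J A → ∃ j ∈ J, spineMove q J j A ∈ T)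
    {R : CentreRule K} (hR : IsPermissibleRule q R) (s₀ : State K) (h0 : s₀.F.support ∈ T) :
    ∃ c : ℕ → State K, c 0 = s₀ ∧ ∀ k, (c k).F.support ∈ T ∧
      IsPermissibleCentre q (R (c k)) (c k).F ∧ SpineEdge q (R (c k)) (c k) (c (k + 1)) := by
  have key : ∀ s : {s : State K // s.F.support ∈ T}, ∃ s' : {s : State K // s.F.support ∈ T},
      IsPermissibleCentre q (R s.1) s.1.F ∧ SpineEdge q (R s.1) s.1 s'.1 := by
    rintro ⟨s, hs⟩
    obtain ⟨hnw, hall⟩ := hT _ hs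
    have huniv : IsPermissibleCentre q Finset.univ s.F :=
      (spinePermissible_support_iff q _ s.F).mp
        (SpinePositional.spinePermissible_univ_of_not_spineWon q hnw)
    have hperm : IsPermissibleCentre q (R s) s.F := hR s ⟨_, huniv⟩
    obtain ⟨j, hj, hmem⟩ := hall (R s) ((spinePermissible_support_iff q _ s.F).mpr hperm)
    have hsupp : (CentreBlowup.step q (R s) j (0 : Fin 4 → K) s).F.support ∈ T := by
      rw [support_step_origin hj s hperm]
      exact hmem
    refine ⟨⟨CentreBlowup.step q (R s) j (0 : Fin 4 → K) s, hsupp⟩, hperm, j, hj, ?_, ?_, rfl⟩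
    · exact isEquimultiplePoint_origin_of_not_spineWon hj s hperm (hT _ hmem).1
    · intro hz
      apply (hT _ hmem).1
      left
      rw [← support_step_origin hj s hperm, hz, MvPolynomial.support_zero]
  choose f hf using key
  refine ⟨fun k => (f^[k] ⟨s₀, h0⟩).1, rfl, fun k => ⟨(f^[k] ⟨s₀, h0⟩).2, ?_⟩⟩
  show IsPermissibleCentre q (R (f^[k] ⟨s₀, h0⟩).1) (f^[k] ⟨s₀, h0⟩).1.F ∧
    SpineEdge q (R (f^[k] ⟨s₀, h0⟩).1) (f^[k] ⟨s₀, h0⟩).1 (f^[k + 1] ⟨s₀, h0⟩).1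
  rw [Function.iterate_succ_apply']
  exact hf _

/-- **A nonempty support spine-trap defeats every permissible coordinate-centre rule over every
field** (the support-level kill certificate for F4-S). [folklore] -/
theorem not_spineTerminatesUnder_of_spineTrap {q : ℕ} {T : Set SpinePos}
    (hT : ∀ A ∈ T, ¬ SpineWon q A ∧ ∀ J, SpinePermissible q J A → ∃ j ∈ J, spineMove q J j A ∈ T)
    (hne : T.Nonempty) {R : CentreRule K} (hR : IsPermissibleRule q R) :
    ¬ SpineTerminatesUnder q R := by
  obtain ⟨A, hA⟩ := hne
  obtain ⟨F, hF⟩ := exists_support_eq (K := K) A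
  have h0 : (⟨F, 0, ∅⟩ : State K).F.support ∈ T := by
    show F.support ∈ T
    rw [hF]
    exact hA
  obtain ⟨c, -, hc⟩ := exists_chain_of_spineTrap hT hR ⟨F, 0, ∅⟩ h0
  intro hterm
  exact hterm ⟨c, fun k => (hc k).2⟩

/-! ## §2 The converse over one field, and the exact existential dictionary -/

/-- **The converse of PR-9b over one field.** If over SOME field some permissible coordinate-centre
rule — reading whatever it likes of the state — has no infinite spine branch, then player A wins the
support game with deletions positionally from every position. [folklore] -/
theorem positionalWin4_of_exists_spineTerminating_rule (q : ℕ)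
    (h : ∃ R : CentreRule K, IsPermissibleRule q R ∧ SpineTerminatesUnder q R) :
    PositionalWin4 q := by
  by_contra hW
  obtain ⟨T, hne, hT⟩ := (SpinePositional.not_positionalWin4_iff_exists_spineTrap q).mp hW
  obtain ⟨R, hR, hterm⟩ := h
  exact not_spineTerminatesUnder_of_spineTrap hT hne hR hterm

/-- PR-9b at the level of one field (the construction of `spineTerminatesSomeRule_of_positionalWin4`,
which needs no characteristic hypothesis): a positional win gives a spine-terminating permissible rule
over `K`. [folklore] -/
theorem exists_spineTerminating_rule_of_positionalWin4 (q : ℕ) (h : PositionalWin4 q) :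
    ∃ R : CentreRule K, IsPermissibleRule q R ∧ SpineTerminatesUnder q R := by
  obtain ⟨σ, hσperm, hσwin⟩ := h
  have hR : ∀ s : State K, s.F ≠ 0 →
      (fun s : State K => if s.F = 0 then (Finset.univ : Finset (Fin 4)) else σ s.F.support) s
        = σ s.F.support := fun s hs => by
    dsimp only
    rw [if_neg hs]
  have hR0 : ∀ s : State K, s.F = 0 →
      ((fun s : State K => if s.F = 0 then (Finset.univ : Finset (Fin 4)) else σ s.F.support)
        s).Nonempty := fun s hs => by
    dsimp only
    rw [if_pos hs]
    exact Finset.univ_nonempty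
  exact ⟨fun s => if s.F = 0 then Finset.univ else σ s.F.support,
    isPermissibleRule_of_agrees q σ hσperm hR hR0,
    (spineTerminatesUnder_iff_of_agrees q σ hσperm hR).mpr hσwin⟩

/-- **The exact existential dictionary over ANY single field**: some permissible coordinate-centre
rule has no infinite spine branch over `K` iff the support game with deletions is won positionally.
In particular the left-hand side does not depend on `K`. [folklore] -/
theorem exists_spineTerminating_rule_iff_positionalWin4 (q : ℕ) :
    (∃ R : CentreRule K, IsPermissibleRule q R ∧ SpineTerminatesUnder q R) ↔ PositionalWin4 q :=
  ⟨positionalWin4_of_exists_spineTerminating_rule q, exists_spineTerminating_rule_of_positionalWin4 q⟩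

end OneField

/-! ## §3 F4-S is the support game -/

/-- Any ONE field of characteristic `p` witnesses the converse: F4-S at `(p, q)` gives the positional
win of the support game. [folklore] -/
theorem positionalWin4_of_spineTerminatesSomeRule (p q : ℕ) (K : Type) [Field K] [CharP K p]
    [DecidableEq K] (h : SpineTerminatesSomeRule p q) : PositionalWin4 q :=
  positionalWin4_of_exists_spineTerminating_rule q (h K)

/-- **F4-S IS THE SUPPORT GAME (prime characteristic).** `SpineTerminatesSomeRule p q ↔
PositionalWin4 q`: on the spine the coordinate-centre frame loses nothing — a spine-terminating
permissible rule exists over every field of characteristic `p` iff Hironaka's pure game with cleaning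
deletions on `Finset (Fin 4 →₀ ℕ)` is won positionally (← is PR-9b; → uses `ZMod p`).
[OURS · counted 0] [folklore] -/
theorem spineTerminatesSomeRule_iff_positionalWin4 (p q : ℕ) [Fact p.Prime] :
    SpineTerminatesSomeRule p q ↔ PositionalWin4 q :=
  ⟨fun h => positionalWin4_of_spineTerminatesSomeRule p q (ZMod p) h,
    spineTerminatesSomeRule_of_positionalWin4 p q⟩

/-- The same in characteristic `0` (witness `ℚ`). [folklore] -/
theorem spineTerminatesSomeRule_zero_iff_positionalWin4 (q : ℕ) :
    SpineTerminatesSomeRule 0 q ↔ PositionalWin4 q :=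
  ⟨fun h => positionalWin4_of_spineTerminatesSomeRule 0 q ℚ h,
    spineTerminatesSomeRule_of_positionalWin4 0 q⟩

/-- **FIELD INDEPENDENCE of F4-S.** For any one field `K` of characteristic `p`:
`SpineTerminatesSomeRule p q` (all fields of characteristic `p`) iff some permissible rule over `K`
alone has no infinite spine branch. [folklore] -/
theorem spineTerminatesSomeRule_iff_exists_rule (p q : ℕ) (K : Type) [Field K] [CharP K p]
    [DecidableEq K] :
    SpineTerminatesSomeRule p q ↔
      ∃ R : CentreRule K, IsPermissibleRule q R ∧ SpineTerminatesUnder q R :=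
  ⟨fun h => h K, fun h =>
    spineTerminatesSomeRule_of_positionalWin4 p q (positionalWin4_of_exists_spineTerminating_rule q h)⟩

/-- **F4-S ⟺ every position of the support game lies in player A's attractor** (p-14's `Game.Wins`
for the spine move; no strategy, no positionality, no field). [folklore] -/
theorem spineTerminatesSomeRule_iff_forall_wins (p q : ℕ) [Fact p.Prime] :
    SpineTerminatesSomeRule p q ↔
      ∀ A : SpinePos, Game.Wins
        (fun (A : SpinePos) (J : Finset (Fin 4)) => ¬ SpineWon q A ∧ SpinePermissible q J A)
        (fun A J A' => ∃ j ∈ J, A' = spineMove q J j A) A := by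
  rw [spineTerminatesSomeRule_iff_positionalWin4, SpinePositional.positionalWin4_iff_forall_wins]

end SpineDictionary

end Summit.ResolutionOfSingularities.ResolutionOfSingularities.Theorems.PIDim4

end
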